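import Summits.BirchSwinnertonDyer.Rank1Residual.Additive.RamifiedSevenResidueIsGenusUnitClassOfIntegralComparison
import HarnessLib

set_option autoImplicit false

/-!
# `𝒞₇` genus road (crux `EllipticUnitValueSevenOfGZK`, K7r) — the DIVISIBILITY KERNEL of the pinned K2ᶜ stub, RE-CUT
# (bsd-idea-20 g64, crux workfile; scratch next to (P3) `RamifiedSevenResidueIsGenusUnitClassOfIntegralComparison.lean`)

Pure algebra on a pinned frame `Φ : PinnedKatoGenusFrame W K hK I d`; THEOREMS + four `Prop`-valued predicates (`StrongComparisonShape`, `PeriodScaledComparisonShape`, `TwoSidedComparisonShape`, proposal `PeriodPositionShape`); nothing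
asserted, no named fact, no `sorry`.

(P3) splits the registered K2ᶜ letter `IntegralComparisonShape Φ` (`EU_𝔟 = C_𝔟 • 𝐳_{γ′}`, `C_𝔟 ∈ Λ_O`) as
`RationalComparisonShape Φ` (`∃ m C, π^m • EU_𝔟 = C • 𝐳_{γ′}`) `∧` `ComparisonDivisibilityShape Φ` (`π^m • EU_𝔟 = C • 𝐳_{γ′}
⇒ π^m ∣ C`), the second conjunct being «the research kernel».  The observation of this file: the kernel is NOT derivable from
the rational half AS TYPED (the `∃ m C` forgets the constant), but it is ONE DIVISIBILITY OF ONE SCALAR as soon as the rational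
half is typed with its constant — which is how print gives it ((15.16.1)∘15.14: `EU_𝔞 = u·x_𝔞·𝐳_{γ′}`, ONE constant for all
admissible `𝔞`; at a general pinned frame the constant is `c/π^n` with `(n, c)` read off the period normalisations `Ω`
(λ1), `t` (§5) and `(u, a)` (L3)).

* `StrongComparisonShape Φ` := F7's `CMTwisted.Kato15161StrongShape 7 Φ.𝔣 Φ.frame` (`∃ c₁ ∈ Λ_O^×, EU_𝔟 = (c₁·x_𝔟) • 𝐳_{γ′}`);
* `PeriodScaledComparisonShape Φ n c` := `∀ 𝔟` admissible, `π^n • EU_𝔟 = (c·x_𝔟) • 𝐳_{γ′}` — the EXACT-CONSTANT form of the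
  rational half;
* Strong ⇒ PeriodScaled `0 c₁` ⇒ Integral;  PeriodScaled `n c` ⇒ Rational;  PeriodScaled `n c` ∧ `π^n ∣ c` ⇒ Integral (no
  `π`-torsion in `𝐇′(𝒱′)`) ⇒ Divisibility (trivial annihilator of `𝐳_{γ′}`);
* CONVERSELY PeriodScaled `n c` ∧ Divisibility ⇒ `π^n ∣ c`, as soon as ONE admissible twist has `x_𝔞` coprime to `π`
  (the frame's own `Φ.𝔞` — memo LEMMA M: a degree-one `𝔞 ∤ 42𝔣` with `N𝔞 ≢ 1 mod 7`);
* hence, under the exact-constant rational half, `ComparisonDivisibilityShape Φ ↔ π^n ∣ c` («PERIOD-UNIT» scalar statement);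
* §6 (REV 1.1): `TwoSidedComparisonShape Φ s c` := `∀ 𝔟` admissible, `s • EU_𝔟 = (c·x_𝔟) • 𝐳_{γ′}` — the raw TWO-SIDED output of a
  value-comparison + separation argument (the cell's LEMMA S) with BOTH constants named; with `s = w·π^n`, `c = w′·π^N` unit-normalised
  the kernel is the EXPONENT INEQUALITY `n ≤ N` (`TwoSidedComparisonShape.divisibility_iff_le`; ⇐ needs `ann(𝐳_{γ′}) = 0`, ⇒ needs
  `x_𝔞` π-primitive and `π^{m+1} ∤ π^m` in `Λ_O`) — in the (R3) currency `n = v₇(N_{K/ℚ}α) + v_π(t)`, `N = 2(e+k) + a` ((KI) of the memo).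

[cite: Kato2004Asterisque, §15.16 (15.16.1) (p. 265), Prop. 15.17 proof last line (p. 265, "similarly by using 15.14"),
15.14 (p. 264), Thm. 12.4 (2) (p. 221), 13.5 (p. 227)] — page cites as carried by the tree docstrings of (B1b)/(P1)/(P3) and
`Kato2004/CMTwistedIwasawaModules.lean` §2; reading note `Cruxes/EllipticUnitValueSevenOfGZK/K2cCollapse-g57.md` §2.
-/

noncomputable section

open scoped NumberField
open Field IsDedekindDomain NumberField
open Literature.NumberTheory.GaloisRepresentations
open Literature.NumberTheory.EllipticCurves
open Literature.NumberTheory.EllipticCurves.Rank1Residual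
open Literature.NumberTheory.EllipticCurves.IwasawaAlgebra
open Literature.NumberTheory.EllipticCurves.Kato2004
open Literature.NumberTheory.ComplexMultiplication.EllipticUnits
open Summit.BirchSwinnertonDyer.Rank1Residual

namespace Summit.BirchSwinnertonDyer.Rank1Residual.Additive.GenusSeven

section Frame

variable {W : WeierstrassCurve ℚ} [W.IsElliptic] [W.IsGloballyMinimal] [Fact (Nat.Prime 7)]
  [ContinuousSMul ℤ_[7] (W.tateModule 7)] {K : ZpExtension ℚ 7} {hK : K.IsCyclotomic}
  {γ : Field.absoluteGaloisGroup ℚ} {I : IwasawaH1Data W 7 K γ}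
  {F : GenusFrame} {θu : ∀ n : ℕ, globalUnitsOf (F.layer n)} {d : GenusDatum F θu}

/-! ## §1 The two exact-constant shapes -/

/-- **`StrongComparisonShape Φ` — (15.16.1)∘15.14 with its PRINTED constant, at the pinned frame**: F7's
`Kato15161StrongShape` («`EU_𝔟 = (c₁·x_𝔟) • 𝐳_{γ′}` with ONE `c₁ ∈ Λ_O^×` for all admissible `𝔟`») at `(p, 𝔣) = (7, Φ.𝔣)` on
`Φ.frame`.  A predicate; NOT asserted. [cite: Kato2004Asterisque, §15.16 (15.16.1) (p. 265)] -/
def StrongComparisonShape (Φ : PinnedKatoGenusFrame W K hK I d) : Prop :=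
  CMTwisted.Kato15161StrongShape (K := Φ.Kcm) 7 Φ.𝔣 Φ.frame

/-- Unfolding `StrongComparisonShape`. [cite: Kato2004Asterisque, §15.16 (15.16.1) (p. 265)] -/
theorem strongComparisonShape_iff (Φ : PinnedKatoGenusFrame W K hK I d) :
    StrongComparisonShape Φ ↔
      ∃ c₁ : (Φ.R)ˣ, ∀ 𝔟 : Ideal (𝓞 Φ.Kcm), IsTwist 7 Φ.𝔣 𝔟 → Φ.frame.EU 𝔟 = ((c₁ : Φ.R) * Φ.frame.x 𝔟) • Φ.frame.zeta :=
  Iff.rfl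

/-- **`PeriodScaledComparisonShape Φ n c` — the rational half WITH ITS CONSTANT**: `π^n • EU_𝔟 = (c·x_𝔟) • 𝐳_{γ′}` for every
admissible `𝔟`, with ONE pair `(n, c)`, `c ∈ Λ_O` (in Kato's frame `c/π^n = u·(period ratio)`, the ratio of the (λ1) period `Ω`
normalising `EU` to the Betti normalisation of `γ′`).  A predicate; NOT asserted.
[cite: Kato2004Asterisque, §15.16 (15.16.1) (p. 265) with (15.12.2) (p. 263) and Thm. 12.5 (1) (p. 221)] -/
def PeriodScaledComparisonShape (Φ : PinnedKatoGenusFrame W K hK I d) (n : ℕ) (c : Φ.R) : Prop :=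
  ∀ 𝔟 : Ideal (𝓞 Φ.Kcm), IsTwist 7 Φ.𝔣 𝔟 → Φ.π ^ n • Φ.frame.EU 𝔟 = (c * Φ.frame.x 𝔟) • Φ.frame.zeta

/-! ## §2 Downward implications (all elementary) -/

/-- Strong ⇒ exact-constant rational half with `n = 0` and a UNIT constant. [cite: Kato2004Asterisque, §15.16 (15.16.1) (p. 265)] -/
theorem StrongComparisonShape.periodScaled {Φ : PinnedKatoGenusFrame W K hK I d} (h : StrongComparisonShape Φ) :
    ∃ c₁ : (Φ.R)ˣ, PeriodScaledComparisonShape Φ 0 (c₁ : Φ.R) := by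
  obtain ⟨c₁, hc⟩ := h
  exact ⟨c₁, fun 𝔟 h𝔟 => by rw [pow_zero, one_smul, hc 𝔟 h𝔟]⟩

/-- Strong ⇒ Integral (= (B1b)'s weak form; `C_𝔟 = c₁·x_𝔟`). [cite: Kato2004Asterisque, §15.16 (15.16.1) (p. 265)] -/
theorem StrongComparisonShape.integral {Φ : PinnedKatoGenusFrame W K hK I d} (h : StrongComparisonShape Φ) :
    IntegralComparisonShape Φ :=
  CMTwisted.Kato15161StrongShape.weak (K := Φ.Kcm) 7 Φ.𝔣 h

/-- Exact-constant ⇒ Rational (forget the constant: `m = n`, `C = c·x_𝔟`). [cite: Kato2004Asterisque, §15.16 (15.16.1) (p. 265)] -/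
theorem PeriodScaledComparisonShape.rational {Φ : PinnedKatoGenusFrame W K hK I d} {n : ℕ} {c : Φ.R}
    (h : PeriodScaledComparisonShape Φ n c) : RationalComparisonShape Φ :=
  fun 𝔟 h𝔟 => ⟨n, c * Φ.frame.x 𝔟, h 𝔟 h𝔟⟩

/-- Shifting the exponent: `(n, c) ↦ (n + 1, π·c)`. [cite: Kato2004Asterisque, §15.16 (15.16.1) (p. 265)] -/
theorem PeriodScaledComparisonShape.succ {Φ : PinnedKatoGenusFrame W K hK I d} {n : ℕ} {c : Φ.R}
    (h : PeriodScaledComparisonShape Φ n c) : PeriodScaledComparisonShape Φ (n + 1) (Φ.π * c) := by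
  intro 𝔟 h𝔟
  rw [pow_succ', mul_smul, h 𝔟 h𝔟, smul_smul, mul_assoc]

/-- **Exact-constant ∧ `π^n ∣ c` ⇒ Integral** (cancel `π^n` in the `π`-torsion-free `𝐇′(𝒱′)`; constant `C_𝔟 = (c/π^n)·x_𝔟`).
[cite: Kato2004Asterisque, Thm. 12.4 (2) (p. 221, "torsion free") and §15.16 (15.16.1) (p. 265)] -/
theorem PeriodScaledComparisonShape.integral_of_dvd {Φ : PinnedKatoGenusFrame W K hK I d} {n : ℕ} {c : Φ.R}
    (h : PeriodScaledComparisonShape Φ n c) (hc : Φ.π ^ n ∣ c) : IntegralComparisonShape Φ := by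
  obtain ⟨c', rfl⟩ := hc
  intro 𝔟 h𝔟
  refine ⟨c' * Φ.frame.x 𝔟, sub_eq_zero.mp (Φ.torsionFree_π_pow n _ ?_)⟩
  rw [smul_sub, h 𝔟 h𝔟, smul_smul, ← mul_assoc, sub_self]

/-- … with a UNIT quotient it is even the strong form. [cite: Kato2004Asterisque, §15.16 (15.16.1) (p. 265)] -/
theorem PeriodScaledComparisonShape.strong_of_eq_mul_unit {Φ : PinnedKatoGenusFrame W K hK I d} {n : ℕ} {c : Φ.R}
    (h : PeriodScaledComparisonShape Φ n c) (c₁ : (Φ.R)ˣ) (hc : c = Φ.π ^ n * c₁) : StrongComparisonShape Φ := by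
  subst hc
  refine ⟨c₁, fun 𝔟 h𝔟 => sub_eq_zero.mp (Φ.torsionFree_π_pow n _ ?_)⟩
  rw [smul_sub, h 𝔟 h𝔟, smul_smul, ← mul_assoc, sub_self]

/-- **Exact-constant ∧ `π^n ∣ c` ⇒ the kernel**, when `𝐳_{γ′}` has trivial annihilator ((P3) `IntegralComparisonShape.divisibility`).
[cite: Kato2004Asterisque, Thm. 12.4 (2) (p. 221) and 13.5 (p. 227)] -/
theorem PeriodScaledComparisonShape.divisibility_of_dvd {Φ : PinnedKatoGenusFrame W K hK I d} {n : ℕ} {c : Φ.R}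
    (h : PeriodScaledComparisonShape Φ n c) (hc : Φ.π ^ n ∣ c) (hz : ∀ r : Φ.R, r • Φ.frame.zeta = 0 → r = 0) :
    ComparisonDivisibilityShape Φ :=
  (h.integral_of_dvd hc).divisibility hz

/-! ## §3 The converse: the kernel IS the scalar divisibility `π^n ∣ c` -/

/-- **Kernel ⇒ `π^n ∣ c`**: apply `ComparisonDivisibilityShape` to the ONE admissible twist `Φ.𝔞` of the frame, whose `x_𝔞` is
coprime to every power of `π` (memo LEMMA M: `x_𝔞 ≢ 0 mod π` in the domain `Λ_O/π = 𝔽₇⟦Γ⟧`, and `π` is prime in `Λ_O`).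
No annihilator hypothesis is needed in this direction. [cite: Kato2004Asterisque, §15.6 (p. 254, "N(𝔞) − σ_𝔞") and §15.16 (15.16.1) (p. 265)] -/
theorem PeriodScaledComparisonShape.dvd_of_divisibility {Φ : PinnedKatoGenusFrame W K hK I d} {n : ℕ} {c : Φ.R}
    (h : PeriodScaledComparisonShape Φ n c) (hD : ComparisonDivisibilityShape Φ)
    (hx : ∀ (k : ℕ) (r : Φ.R), Φ.π ^ k ∣ r * Φ.frame.x Φ.𝔞 → Φ.π ^ k ∣ r) : Φ.π ^ n ∣ c := by
  obtain ⟨C', hC'⟩ := hD Φ.𝔞 Φ.isTwist_𝔞 n (c * Φ.frame.x Φ.𝔞) (h Φ.𝔞 Φ.isTwist_𝔞)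
  exact hx n c ⟨C', hC'⟩

/-- **THE RE-CUT.** Under the exact-constant rational half `PeriodScaledComparisonShape Φ n c`, the research kernel
`ComparisonDivisibilityShape Φ` is EQUIVALENT to the scalar divisibility `π^n ∣ c` in `Λ_O` (given the two standing side
conditions of Kato's frame: `𝐳_{γ′}` has trivial annihilator — it is a non-zero element of the torsion-free rank-one `𝐇′(𝒱′)` over
the domain `Λ_O` — and `x_𝔞` is `π`-coprime for the frame's twist `𝔞`).
[cite: Kato2004Asterisque, §15.16 (15.16.1) (p. 265), Thm. 12.4 (2) (p. 221), 13.5 (p. 227)] -/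
theorem comparisonDivisibilityShape_iff_dvd {Φ : PinnedKatoGenusFrame W K hK I d} {n : ℕ} {c : Φ.R}
    (h : PeriodScaledComparisonShape Φ n c) (hz : ∀ r : Φ.R, r • Φ.frame.zeta = 0 → r = 0)
    (hx : ∀ (k : ℕ) (r : Φ.R), Φ.π ^ k ∣ r * Φ.frame.x Φ.𝔞 → Φ.π ^ k ∣ r) :
    ComparisonDivisibilityShape Φ ↔ Φ.π ^ n ∣ c :=
  ⟨fun hD => h.dvd_of_divisibility hD hx, fun hc => h.divisibility_of_dvd hc hz⟩

/-- … and equally to the INTEGRAL comparison itself (so, once the rational half carries its constant, K2ᶜ-pinned ⇔ `π^n ∣ c`).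
[cite: Kato2004Asterisque, §15.16 (15.16.1) (p. 265), Thm. 12.4 (2) (p. 221)] -/
theorem integralComparisonShape_iff_dvd {Φ : PinnedKatoGenusFrame W K hK I d} {n : ℕ} {c : Φ.R}
    (h : PeriodScaledComparisonShape Φ n c) (hz : ∀ r : Φ.R, r • Φ.frame.zeta = 0 → r = 0)
    (hx : ∀ (k : ℕ) (r : Φ.R), Φ.π ^ k ∣ r * Φ.frame.x Φ.𝔞 → Φ.π ^ k ∣ r) :
    IntegralComparisonShape Φ ↔ Φ.π ^ n ∣ c :=
  ⟨fun hI => h.dvd_of_divisibility (hI.divisibility hz) hx, fun hc => h.integral_of_dvd hc⟩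

/-- **Uniqueness of the constant** at fixed exponent: two exact constants `c, c'` at the same `n` agree, given the trivial
annihilator of `𝐳_{γ′}` and ONE admissible twist whose `x_𝔞` is a non-zero-divisor (the frame's `Φ.𝔞`).
[cite: Kato2004Asterisque, Thm. 12.4 (2) (p. 221) and §15.6 (p. 254)] -/
theorem PeriodScaledComparisonShape.const_unique {Φ : PinnedKatoGenusFrame W K hK I d} {n : ℕ} {c c' : Φ.R}
    (h : PeriodScaledComparisonShape Φ n c) (h' : PeriodScaledComparisonShape Φ n c')
    (hz : ∀ r : Φ.R, r • Φ.frame.zeta = 0 → r = 0) (hx0 : ∀ r : Φ.R, r * Φ.frame.x Φ.𝔞 = 0 → r = 0) : c = c' := by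
  refine sub_eq_zero.mp (hx0 _ (hz _ ?_))
  rw [sub_mul, sub_smul, ← h Φ.𝔞 Φ.isTwist_𝔞, ← h' Φ.𝔞 Φ.isTwist_𝔞, sub_self]

end Frame

/-! ## §4 What the registered letter then needs: the exact-constant half + ONE scalar divisibility -/

/-- **«K2cPinned» from the EXACT-CONSTANT rational half and the period-unit divisibility** — the form in which the registered
stub `stub_integralComparisonSeven` can shrink once row (K2C-2) types its reduction WITH the constant: the kernel conjunct
`ComparisonDivisibilityShape` is replaced by the scalar `π^n ∣ c` (binders = (P3) `k2cPinned_of_rational_of_divisibility` with the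
last line changed).  CONDITIONAL; nothing asserted. [cite: Kato2004Asterisque, §15.16 (15.16.1) (p. 265), Thm. 12.4 (2) (p. 221)] -/
theorem k2cPinned_of_periodScaled_of_dvd
    (hPD : exists_zetaClassPosition_of_rank_le_one → rank_eq_analyticRank_of_analyticRank_le_one →
      ∀ (W : WeierstrassCurve ℚ) [W.IsElliptic] [W.IsGloballyMinimal] [Fact (Nat.Prime 7)], X12.ClassCSeven W →
      letI : ContinuousSMul ℤ_[7] (W.tateModule 7) := TateModule.continuousSMul_padicInt
      ∀ (K : ZpExtension ℚ 7) (hK : K.IsCyclotomic) (γ : Field.absoluteGaloisGroup ℚ) (_ : K.IsTopGenerator γ)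
        (I : IwasawaH1Data W 7 K γ),
        ∃ (F : GenusFrame) (θu : ∀ n : ℕ, globalUnitsOf (F.layer n)), IsNormedEllipticUnitFamily F θu ∧
          ∀ d : GenusDatum F θu, ∃ (Φ : PinnedKatoGenusFrame W K hK I d) (n : ℕ) (c : Φ.R),
            PeriodScaledComparisonShape Φ n c ∧ Φ.π ^ n ∣ c) :
    exists_zetaClassPosition_of_rank_le_one → rank_eq_analyticRank_of_analyticRank_le_one →
      ∀ (W : WeierstrassCurve ℚ) [W.IsElliptic] [W.IsGloballyMinimal] [Fact (Nat.Prime 7)], X12.ClassCSeven W →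
      letI : ContinuousSMul ℤ_[7] (W.tateModule 7) := TateModule.continuousSMul_padicInt
      ∀ (K : ZpExtension ℚ 7) (hK : K.IsCyclotomic) (γ : Field.absoluteGaloisGroup ℚ) (_ : K.IsTopGenerator γ)
        (I : IwasawaH1Data W 7 K γ),
        ∃ (F : GenusFrame) (θu : ∀ n : ℕ, globalUnitsOf (F.layer n)), IsNormedEllipticUnitFamily F θu ∧
          ∀ d : GenusDatum F θu, ∃ Φ : PinnedKatoGenusFrame W K hK I d,
            ResidueIsGenusUnitClassShape Φ.toKatoGenusFrame := by
  intro hstar hGZK W _ _ _ hC K hK γ hγ I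
  haveI : ContinuousSMul ℤ_[7] (W.tateModule 7) := TateModule.continuousSMul_padicInt
  obtain ⟨F, θu, hpin, hΦ⟩ := hPD hstar hGZK W hC K hK γ hγ I
  refine ⟨F, θu, hpin, fun d => ?_⟩
  obtain ⟨Φ, n, c, hP, hc⟩ := hΦ d
  exact ⟨Φ, hP.integral_of_dvd hc⟩

/-- **… and from the STRONG form** (the canonical inhabitant's case: `c₁ = u ∈ Λ_O^×`, `n = 0`). CONDITIONAL; nothing asserted.
[cite: Kato2004Asterisque, §15.16 (15.16.1) (p. 265)] -/
theorem k2cPinned_of_strong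
    (hS : exists_zetaClassPosition_of_rank_le_one → rank_eq_analyticRank_of_analyticRank_le_one →
      ∀ (W : WeierstrassCurve ℚ) [W.IsElliptic] [W.IsGloballyMinimal] [Fact (Nat.Prime 7)], X12.ClassCSeven W →
      letI : ContinuousSMul ℤ_[7] (W.tateModule 7) := TateModule.continuousSMul_padicInt
      ∀ (K : ZpExtension ℚ 7) (hK : K.IsCyclotomic) (γ : Field.absoluteGaloisGroup ℚ) (_ : K.IsTopGenerator γ)
        (I : IwasawaH1Data W 7 K γ),
        ∃ (F : GenusFrame) (θu : ∀ n : ℕ, globalUnitsOf (F.layer n)), IsNormedEllipticUnitFamily F θu ∧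
          ∀ d : GenusDatum F θu, ∃ Φ : PinnedKatoGenusFrame W K hK I d, StrongComparisonShape Φ) :
    exists_zetaClassPosition_of_rank_le_one → rank_eq_analyticRank_of_analyticRank_le_one →
      ∀ (W : WeierstrassCurve ℚ) [W.IsElliptic] [W.IsGloballyMinimal] [Fact (Nat.Prime 7)], X12.ClassCSeven W →
      letI : ContinuousSMul ℤ_[7] (W.tateModule 7) := TateModule.continuousSMul_padicInt
      ∀ (K : ZpExtension ℚ 7) (hK : K.IsCyclotomic) (γ : Field.absoluteGaloisGroup ℚ) (_ : K.IsTopGenerator γ)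
        (I : IwasawaH1Data W 7 K γ),
        ∃ (F : GenusFrame) (θu : ∀ n : ℕ, globalUnitsOf (F.layer n)), IsNormedEllipticUnitFamily F θu ∧
          ∀ d : GenusDatum F θu, ∃ Φ : PinnedKatoGenusFrame W K hK I d,
            ResidueIsGenusUnitClassShape Φ.toKatoGenusFrame := by
  intro hstar hGZK W _ _ _ hC K hK γ hγ I
  haveI : ContinuousSMul ℤ_[7] (W.tateModule 7) := TateModule.continuousSMul_padicInt
  obtain ⟨F, θu, hpin, hΦ⟩ := hS hstar hGZK W hC K hK γ hγ I
  refine ⟨F, θu, hpin, fun d => ?_⟩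
  obtain ⟨Φ, hΦS⟩ := hΦ d
  exact ⟨Φ, hΦS.integral⟩


/-! ## §5 PROPOSAL (typing target, not used above): the period-position clause that makes `π^n ∣ c` decidable at a frame -/

section Proposal

variable {W : WeierstrassCurve ℚ} [W.IsElliptic] [W.IsGloballyMinimal] [Fact (Nat.Prime 7)]
  [ContinuousSMul ℤ_[7] (W.tateModule 7)] {K : ZpExtension ℚ 7} {hK : K.IsCyclotomic}
  {γ : Field.absoluteGaloisGroup ℚ} {I : IwasawaH1Data W 7 K γ}
  {F : GenusFrame} {θu : ∀ n : ℕ, globalUnitsOf (F.layer n)} {d : GenusDatum F θu}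

/-- **`PeriodPositionShape Φ` — PROPOSED period clause for the (R3) datum of row (K2C-2)**: the (λ1) period `Ω` of the pinned
frame is `2^j·ρ·Ω_W⁺` with `ρ ∈ K^×` (PERIOD RATIONALITY: `Ω = per_ψ`-period of a Betti vector `γ₀` of the `K`-line `H¹(W(ℂ), ℚ)`,
and `Ω(γ₀) = 2κ(γ₀)·Ω_W⁺` with `δ⁺ = [κ(γ₀)]^*γ₀`, Hodge theory of the CM curve) sitting at `𝔭`-adic distance AT MOST `a_W` above
`Ω_W⁺` (PERIOD POSITION: `v_𝔭(ρ) = v₇(N_{K/ℚ} ρ) ≤ a`, i.e. `γ₀` is `7`-integral — Kato's classes (15.6.3)/(15.12.1) are integral for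
`γ₀` in the lattice; `= a_W` for a generator, by the lattice lemma (L3)).  Under the exact-constant rational half the comparison
constant is `c/π^n = (u/2t)·π^{a − v_𝔭(ρ)}·(unit)`, so THIS clause is what decides `π^n ∣ c` (§3).  `W.realPeriodRat` is the tree's
Néron real period; the power of `2` absorbs its component convention and Kato's `½`/coset constants (all `7`-units).  A predicate;
NOT asserted; NOT consumed in this file. [cite: Kato2004Asterisque, §15.6 (15.6.3) (p. 254), §15.8 (15.8.1) (p. 257), 15.11 (2) with (15.11.3) (pp. 261–262), (15.12.1) (p. 262)] -/
def PeriodPositionShape (Φ : PinnedKatoGenusFrame W K hK I d) : Prop :=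
  ∃ (ρ : Φ.Kcm) (j : ℕ), ρ ≠ 0 ∧
    Φ.Ω = (2 : ℂ) ^ j * Φ.ιC (algebraMap Φ.Kcm (AlgebraicClosure Φ.Kcm) ρ) * ((W.realPeriodRat : ℝ) : ℂ) ∧
    padicValRat 7 (Algebra.norm ℚ ρ) ≤ (Φ.a : ℤ)

end Proposal


/-! ## §6 The TWO-SIDED letter (LEMMA S's raw output, both constants named) and the kernel as an EXPONENT INEQUALITY (KI) -/

section TwoSided

variable {W : WeierstrassCurve ℚ} [W.IsElliptic] [W.IsGloballyMinimal] [Fact (Nat.Prime 7)]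
  [ContinuousSMul ℤ_[7] (W.tateModule 7)] {K : ZpExtension ℚ 7} {hK : K.IsCyclotomic}
  {γ : Field.absoluteGaloisGroup ℚ} {I : IwasawaH1Data W 7 K γ}
  {F : GenusFrame} {θu : ∀ n : ℕ, globalUnitsOf (F.layer n)} {d : GenusDatum F θu}

/-- **`TwoSidedComparisonShape Φ s c`** — «`s • EU_𝔟 = (c · x_𝔟) • zeta` for every admissible twist», both constants `s, c ∈ Λ_O`
NAMED and uniform in `𝔟`.  This is the raw shape a value-comparison-plus-SEPARATION argument (Kato 15.14–15.16; the cell's LEMMA S,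
`pub/bsd-cm` STATUS l.3650) delivers: `s` = the image of the ★-side period constant `α ∈ K^×` times the gauge `t`, `c` = `7^{e+k}·u·π^a`
times units (memo `DivisibilityKernel-g64.md` §3).  A predicate; nothing asserted. [cite: Kato2004Asterisque, 15.14 (p. 264), (15.16.1) (p. 265)] -/
def TwoSidedComparisonShape (Φ : PinnedKatoGenusFrame W K hK I d) (s c : Φ.R) : Prop :=
  ∀ 𝔟 : Ideal (𝓞 Φ.Kcm), IsTwist 7 Φ.𝔣 𝔟 → s • Φ.frame.EU 𝔟 = (c * Φ.frame.x 𝔟) • Φ.frame.zeta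

/-- Normalising the left constant: `s = w·π^n` with `w` a unit ⇒ the exact-constant (period-scaled) shape with exponent `n` and
constant `w⁻¹·c`. -/
theorem TwoSidedComparisonShape.periodScaled {Φ : PinnedKatoGenusFrame W K hK I d} {s c : Φ.R}
    (h : TwoSidedComparisonShape Φ s c) {n : ℕ} {w : Φ.Rˣ} (hs : s = (w : Φ.R) * Φ.π ^ n) :
    PeriodScaledComparisonShape Φ n ((↑w⁻¹ : Φ.R) * c) := by
  intro 𝔟 h𝔟
  have h1 := h 𝔟 h𝔟
  rw [hs] at h1
  calc Φ.π ^ n • Φ.frame.EU 𝔟 = (((↑w⁻¹ : Φ.R) * (w : Φ.R)) * Φ.π ^ n) • Φ.frame.EU 𝔟 := by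
          rw [Units.inv_mul, one_mul]
    _ = (↑w⁻¹ : Φ.R) • (((w : Φ.R) * Φ.π ^ n) • Φ.frame.EU 𝔟) := by rw [mul_assoc, mul_smul]
    _ = (↑w⁻¹ : Φ.R) • ((c * Φ.frame.x 𝔟) • Φ.frame.zeta) := by rw [h1]
    _ = ((↑w⁻¹ : Φ.R) * c * Φ.frame.x 𝔟) • Φ.frame.zeta := by rw [← mul_smul, mul_assoc]

/-- **(KI), sufficiency: `n ≤ N` ⇒ the divisibility kernel.**  With both constants unit-normalised (`s = w·π^n`, `c = w′·π^N`),
the kernel holds as soon as the left exponent does not exceed the right one (needs only `ann(zeta) = 0`). -/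
theorem TwoSidedComparisonShape.divisibility_of_le {Φ : PinnedKatoGenusFrame W K hK I d} {n N : ℕ} {w w' : Φ.Rˣ}
    (h : TwoSidedComparisonShape Φ ((w : Φ.R) * Φ.π ^ n) ((w' : Φ.R) * Φ.π ^ N))
    (hz : ∀ r : Φ.R, r • Φ.frame.zeta = 0 → r = 0) (hle : n ≤ N) : ComparisonDivisibilityShape Φ := by
  refine (h.periodScaled rfl).divisibility_of_dvd ?_ hz
  obtain ⟨e, he⟩ := Nat.exists_eq_add_of_le hle
  exact ⟨(↑w⁻¹ : Φ.R) * (w' : Φ.R) * Φ.π ^ e, by rw [he, pow_add]; ring⟩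

/-- **(KI), sufficiency for the INTEGRAL comparison: `n ≤ N` ⇒ `IntegralComparisonShape Φ`** (no side condition at all). -/
theorem TwoSidedComparisonShape.integral_of_le {Φ : PinnedKatoGenusFrame W K hK I d} {n N : ℕ} {w w' : Φ.Rˣ}
    (h : TwoSidedComparisonShape Φ ((w : Φ.R) * Φ.π ^ n) ((w' : Φ.R) * Φ.π ^ N)) (hle : n ≤ N) :
    IntegralComparisonShape Φ := by
  refine (h.periodScaled rfl).integral_of_dvd ?_
  obtain ⟨e, he⟩ := Nat.exists_eq_add_of_le hle
  exact ⟨(↑w⁻¹ : Φ.R) * (w' : Φ.R) * Φ.π ^ e, by rw [he, pow_add]; ring⟩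

/-- **(KI), necessity: the divisibility kernel ⇒ `n ≤ N`**, given π-primitivity of `x_𝔞` and that `Λ_O` is `π`-adically
separated in the minimal form «`π^{m+1} ∤ π^m`» (true in the domain `Λ_O` with `π` a non-unit); no annihilator hypothesis here. -/
theorem TwoSidedComparisonShape.le_of_divisibility {Φ : PinnedKatoGenusFrame W K hK I d} {n N : ℕ} {w w' : Φ.Rˣ}
    (h : TwoSidedComparisonShape Φ ((w : Φ.R) * Φ.π ^ n) ((w' : Φ.R) * Φ.π ^ N))
    (hx : ∀ (k : ℕ) (r : Φ.R), Φ.π ^ k ∣ r * Φ.frame.x Φ.𝔞 → Φ.π ^ k ∣ r)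
    (hsep : ∀ m : ℕ, ¬ (Φ.π ^ (m + 1) ∣ Φ.π ^ m)) (hK : ComparisonDivisibilityShape Φ) : n ≤ N := by
  have hdvd : Φ.π ^ n ∣ (↑w⁻¹ : Φ.R) * ((w' : Φ.R) * Φ.π ^ N) :=
    (h.periodScaled rfl).dvd_of_divisibility hK hx
  by_contra hlt
  have hlt' : N + 1 ≤ n := Nat.lt_of_not_le hlt
  apply hsep N
  have h2 : Φ.π ^ (N + 1) ∣ (↑w⁻¹ : Φ.R) * ((w' : Φ.R) * Φ.π ^ N) := (pow_dvd_pow Φ.π hlt').trans hdvd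
  have h3 : ((w'⁻¹ * w : Φ.Rˣ) : Φ.R) * ((↑w⁻¹ : Φ.R) * ((w' : Φ.R) * Φ.π ^ N)) = Φ.π ^ N := by
    rw [Units.val_mul]
    calc ((↑w'⁻¹ : Φ.R) * (w : Φ.R)) * ((↑w⁻¹ : Φ.R) * ((w' : Φ.R) * Φ.π ^ N))
          = (↑w'⁻¹ : Φ.R) * (((w : Φ.R) * (↑w⁻¹ : Φ.R)) * ((w' : Φ.R) * Φ.π ^ N)) := by ring
      _ = (↑w'⁻¹ : Φ.R) * ((w' : Φ.R) * Φ.π ^ N) := by rw [Units.mul_inv, one_mul]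
      _ = ((↑w'⁻¹ : Φ.R) * (w' : Φ.R)) * Φ.π ^ N := by ring
      _ = Φ.π ^ N := by rw [Units.inv_mul, one_mul]
  exact h3 ▸ dvd_mul_of_dvd_right h2 _

/-- **THE KERNEL AS AN EXPONENT INEQUALITY.**  For the two-sided letter with unit-normalised constants `s = w·π^n`, `c = w′·π^N`:
`ComparisonDivisibilityShape Φ ↔ n ≤ N`.  In the cell's (R3) currency `n = v₇(N_{K/ℚ} α) + v_π(t)` and `N = 2(e+k) + a` (memo §3),
so this is (KI); the memo's §4 (period position) is the paper argument that `n ≤ N` holds for Kato's objects at the `t := 1` frame. -/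
theorem TwoSidedComparisonShape.divisibility_iff_le {Φ : PinnedKatoGenusFrame W K hK I d} {n N : ℕ} {w w' : Φ.Rˣ}
    (h : TwoSidedComparisonShape Φ ((w : Φ.R) * Φ.π ^ n) ((w' : Φ.R) * Φ.π ^ N))
    (hz : ∀ r : Φ.R, r • Φ.frame.zeta = 0 → r = 0)
    (hx : ∀ (k : ℕ) (r : Φ.R), Φ.π ^ k ∣ r * Φ.frame.x Φ.𝔞 → Φ.π ^ k ∣ r)
    (hsep : ∀ m : ℕ, ¬ (Φ.π ^ (m + 1) ∣ Φ.π ^ m)) : ComparisonDivisibilityShape Φ ↔ n ≤ N :=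
  ⟨h.le_of_divisibility hx hsep, h.divisibility_of_le hz⟩

end TwoSided

end Summit.BirchSwinnertonDyer.Rank1Residual.Additive.GenusSeven

end
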